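/-
Copyright: the b2b-balaban T⁴-continuum CRUX team, row NE7b OWNER lineage `t4-ne7b-p1` (gen 143). Project licence.
-/
import Summits.QuantumFields.BalabanUV.T4Continuum.Spine.NE7b.SupWhitenedFifthFourPointRowLetters
import Summits.QuantumFields.BalabanUV.T4Continuum.Spine.NE7b.SupWhitenedFifthKernelBridges
import Summits.QuantumFields.BalabanUV.T4Continuum.Spine.NE7b.SupWhitenedFourthKernelPieces
import Summits.QuantumFields.BalabanUV.T4Continuum.Spine.NE7b.SupWhitenedMixedThirdCumulantEntry

/-!
# THE MIXED FOURTH CUMULANT'S ROW LETTERS IN THE TILTED GAUSSIAN FORMAT (SCOPING (d14)(2)(vi), bookkeeping).  (576)'s two row letters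
# `Σ_{y,z,t,s}|u₄(G_{xy},F_z,F_t,F_s)|`, `Σ_{y,z,t,s}|u₄(F_x,G_{yz},F_t,F_s)| ≤ n·C·16S³` are stated under the whitened law on `ℝ^κ`; the assembly
# reads the four-point piece `κ₄(U″,U′,U′,U′)` of `∂⁵W`'s centred display in the format `Z⁻¹∫e^{−U(ω+ψ)}(⋯)dN(0,AAᵀ)` with Gaussian centring
# constants.  By the mean bridges (475)∕(508), (522)'s pair bridge and (577)'s mixed pair∕quadruple bridges — term by term under the four sums —
# the SAME letters hold in that format, uniformly in the background, the site `x` and the volume (row NE7b, node U5c; (576), (577), (522), (508),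
# (475) BY NAME; [folklore])

Cell `pub-balaban`, sub-cell `t4`, spine estimate NE7b (`T4WeightBudget.RelWeightBound`; the cell's OWN estimate — NOT PRINTED in
[Bałaban 1983–89], NOT PROVED).  Crux-route work under `Spine/NE7b/` by the row OWNER (`t4-ne7b-p1` gen 143, file (579)) under FREEZE
(0)'s crux-prover clause; NOTHING of Bałaban's is named as a Lean object, valued or asserted; no `T4Continuum/Support` leaf typed; no
`def`, no notation (`u₄` WRITTEN OUT); zero `sorry`.  Imports (BY NAME): the OWNER's (576) `…SupWhitenedFifthFourPointRowLetters`, (577)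
`…SupWhitenedFifthKernelBridges`, (522) `…SupWhitenedFourthKernelPieces` (`whitened_pair_bridge`), (508) `…SupWhitenedMixedThirdCumulantEntry`
(`whitened_hess_mean_bridge`; through it (475) `whitened_mean_bridge`).

WHAT IS PROVED ([folklore]): **`hess_fourth_cumulant_row_letter_tilted`**, **`hess_fourth_cumulant_row_letter_tilted_two`**; toy.

HONEST (what this is NOT).  Format bookkeeping of the four-point piece; the FORM of `∂⁵W` and the assembly of the order-5 kernel letter are NOT
typed.  Scalar skeleton ((A3), NC-NE7b-α UNRULED); nothing of Bałaban's asserted.  BY-NAME EFFECT ON THE WALL: NONE.  NE7b NOT PRINTED ∕ NOT PROVED;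
spine PROVED 0∕9; rung (B)+1 — the programme's measures remain FINITE-torus statements; NOT the mass gap, NOT Clay.  HONEST DEPENDENCY: continuum YM
on T⁴ ⇐ BetaPertH ∧ nine spine estimates (0∕9 proved); BetaPertH ⇐ (D1) ∧ (D4) ∧ CAP+tail; G-an2-4 gates asym, D1 and NE2∕3∕4.
-/

set_option autoImplicit false
set_option maxSynthPendingDepth 2

noncomputable section

namespace Summit.QuantumFields.BalabanUV.T4Continuum.NE7b.SupHessFourthCumulantRowLettersTilted

open MeasureTheory ProbabilityTheory Real Set Function Finset Matrix
open scoped BigOperators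
open Literature.Probability.Distributions (matrixCLM)
open SupWhitenedFifthFourPointRowLetters (four_point5_row_letter_hess four_point5_row_letter_hess_two)
open SupWhitenedFifthKernelBridges (whitened_hess_pair_bridge whitened_grad_hess_pair_bridge whitened_hess_quad_bridge whitened_grad_hess_quad_bridge)
open SupWhitenedFourthKernelPieces (whitened_pair_bridge)
open SupWhitenedThirdKernelLetter (whitened_mean_bridge)
open SupWhitenedMixedThirdCumulantEntry (whitened_hess_mean_bridge)

variable {ι κ : Type} [Fintype ι] [DecidableEq ι] [Fintype κ] [DecidableEq κ]

variable {U : EuclideanSpace ℝ ι → ℝ} {U' : EuclideanSpace ℝ ι → EuclideanSpace ℝ ι →L[ℝ] ℝ}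
  {U'' : EuclideanSpace ℝ ι → EuclideanSpace ℝ ι →L[ℝ] EuclideanSpace ℝ ι →L[ℝ] ℝ}
  {U₃ : EuclideanSpace ℝ ι → EuclideanSpace ℝ ι →L[ℝ] EuclideanSpace ℝ ι →L[ℝ] EuclideanSpace ℝ ι →L[ℝ] ℝ} {Hk : ι → ι → ℝ} {K3 : ι → ι → ι → ℝ}
  {A : Matrix ι κ ℝ} {D : κ → κ → ℝ} {γop κ₀ κ₁ κ₂ κ₃ a τ δ θp lam lamA αr αc hr γ dθ dθ' αθ βθ S : ℝ} {θ : κ → κ → ℝ} {σ : ι → κ → ℝ}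
  {r : ι → ι → ℝ} {n : ℕ}

/-- **THE HESSIAN PAIR CONTAINING `x`, TILTED GAUSSIAN FORMAT**: `Σ_{y,z,t,s}|u₄(G_{xy},F_z,F_t,F_s)| ≤ n·C·16S³`. [folklore] -/
theorem hess_fourth_cumulant_row_letter_tilted [Nonempty κ] (hΓop : (γop • (1 : Matrix ι ι ℝ) - A * Aᵀ).PosSemidef) (Y : Finset ι)
    (hUd : ∀ φ : EuclideanSpace ℝ ι, HasFDerivAt U (U' φ) φ) (hU'd : ∀ φ : EuclideanSpace ℝ ι, HasFDerivAt U' (U'' φ) φ)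
    (hU''d : ∀ φ : EuclideanSpace ℝ ι, HasFDerivAt U'' (U₃ φ) φ) (hU₃c : Continuous U₃) (hκ₀ : 0 ≤ κ₀) (hκ₁ : 0 ≤ κ₁) (ha : 0 ≤ a) (hτ : 0 < τ)
    (hδ : 0 < δ) (hθ0 : 0 < θp) (hθ1 : θp < 1) (hκθ : (2 * κ₀ * (1 + τ) + 4 * δ) * γop ≤ θp) (hκθw : 2 * κ₀ * (1 + τ) * γop + 4 * δ ≤ θp)
    (hstab : ∀ φ : EuclideanSpace ℝ ι, -(κ₀ * ∑ x ∈ Y, φ x ^ 2) ≤ U φ)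
    (hU'b : ∀ φ : EuclideanSpace ℝ ι, ‖U' φ‖ ≤ κ₁ * (a + ∑ x ∈ Y, φ x ^ 2)) (hU''b : ∀ φ : EuclideanSpace ℝ ι, ‖U'' φ‖ ≤ κ₂)
    (hU₃b : ∀ φ : EuclideanSpace ℝ ι, ‖U₃ φ‖ ≤ κ₃) (hlam : 0 ≤ lam)
    (hUsec : ∀ s : ℝ, 0 ≤ s → s ≤ 1 → ∀ a b : EuclideanSpace ℝ ι,
      U ((1 - s) • a + s • b) - lam / 2 * (s * (1 - s)) * ∑ i, (a i - b i) ^ 2 ≤ (1 - s) * U a + s * U b)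
    (hρg : lam * γop < 1)
    (hHk : ∀ (φ : EuclideanSpace ℝ ι) (x z : ι), |U'' φ (EuclideanSpace.single z (1 : ℝ)) (EuclideanSpace.single x (1 : ℝ))| ≤ Hk x z)
    (hHk0 : ∀ v u, 0 ≤ Hk v u)
    (hK3 : ∀ (φ : EuclideanSpace ℝ ι) (u x y : ι),
      |U₃ φ (EuclideanSpace.single u (1 : ℝ)) (EuclideanSpace.single x (1 : ℝ)) (EuclideanSpace.single y (1 : ℝ))| ≤ K3 x y u)
    (hK30 : ∀ x y u, 0 ≤ K3 x y u) (ψ : EuclideanSpace ℝ ι)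
    (hαr : ∀ u, ∑ w, |A u w| ≤ αr) (hαc : ∀ w, ∑ u, |A u w| ≤ αc) (hhr : ∀ v, ∑ u, Hk v u ≤ hr)
    (hlamA : ∀ x : κ, ∑ u, ∑ v, |A u x| * |A v x| * Hk v u ≤ lamA) (hlamA1 : lamA < 1) (hγ : αc * hr * αr / (1 - lamA) ≤ γ) (hγ1 : γ < 1)
    -- the admissible `D` with weighted letters, the weights, the profiles (gradient vectors at their sites, Hessian vectors at the first site)
    (hD : ∀ x y, 0 ≤ D x y)
    (hDC : ∀ x y, (if x = y then (1 : ℝ) else 0) + ∑ z, D x z * ((if y = z then 0 else ∑ u, ∑ v, |A u y| * |A v z| * Hk v u) / (1 - lamA)) ≤ D x y)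
    (hθnn : ∀ z w, 0 ≤ θ z w) (hDr : ∀ z, ∑ w, D z w * θ z w ≤ dθ) (hdθ : 0 ≤ dθ) (hDc : ∀ w, ∑ z, D z w * θ z w ≤ dθ') (hdθ' : 0 ≤ dθ')
    (hσ0 : ∀ x w, 0 ≤ σ x w) (hσθ : ∀ x z w, σ x w ≤ σ x z * θ z w) (hr1 : ∀ x y, 1 ≤ r x y) (hrσ : ∀ x y w, r x y ^ 24 ≤ σ x w * σ y w)
    (haσ : ∀ v : ι, ∑ w, (∑ u, |A u w| * Hk v u) * σ v w ≤ αθ) (hβ : 0 ≤ βθ) (haσ' : ∀ (v : ι) (w : κ), (∑ u, |A u w| * Hk v u) * σ v w ≤ βθ)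
    (hgσ : ∀ p q : ι, ∑ w, (∑ u, |A u w| * K3 p q u) * σ p w ≤ αθ) (hgσ' : ∀ (p q : ι) (w : κ), (∑ u, |A u w| * K3 p q u) * σ p w ≤ βθ)
    (hSr : ∀ u, ∑ v, (r u v ^ 2)⁻¹ ≤ S) (hSc : ∀ v, ∑ u, (r u v ^ 2)⁻¹ ≤ S) (x : ι)
    (hn : (Finset.univ.filter (fun y => Hk y x ≠ 0)).card ≤ n) :
    ∑ y, ∑ z, ∑ t, ∑ s, |((∫ ω : EuclideanSpace ℝ ι, exp (-U (ω + ψ)) ∂(multivariateGaussian 0 (A * Aᵀ)))⁻¹ * (∫ ω : EuclideanSpace ℝ ι, exp (-U (ω +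
        ψ)) * ((U'' (ω + ψ) (EuclideanSpace.single x (1 : ℝ)) (EuclideanSpace.single y (1 : ℝ)) - ((∫ ω : EuclideanSpace ℝ ι, exp (-U (ω + ψ))
        ∂(multivariateGaussian 0 (A * Aᵀ)))⁻¹ * (∫ ω : EuclideanSpace ℝ ι, exp (-U (ω + ψ)) * U'' (ω + ψ) (EuclideanSpace.single x (1 : ℝ))
        (EuclideanSpace.single y (1 : ℝ)) ∂(multivariateGaussian 0 (A * Aᵀ))))) * (U' (ω + ψ) (EuclideanSpace.single z (1 : ℝ)) - ((∫ ω :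
        EuclideanSpace ℝ ι, exp (-U (ω + ψ)) ∂(multivariateGaussian 0 (A * Aᵀ)))⁻¹ * (∫ ω : EuclideanSpace ℝ ι, exp (-U (ω + ψ)) * U' (ω + ψ)
        (EuclideanSpace.single z (1 : ℝ)) ∂(multivariateGaussian 0 (A * Aᵀ))))) * (U' (ω + ψ) (EuclideanSpace.single t (1 : ℝ)) - ((∫ ω :
        EuclideanSpace ℝ ι, exp (-U (ω + ψ)) ∂(multivariateGaussian 0 (A * Aᵀ)))⁻¹ * (∫ ω : EuclideanSpace ℝ ι, exp (-U (ω + ψ)) * U' (ω + ψ)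
        (EuclideanSpace.single t (1 : ℝ)) ∂(multivariateGaussian 0 (A * Aᵀ))))) * (U' (ω + ψ) (EuclideanSpace.single s (1 : ℝ)) - ((∫ ω :
        EuclideanSpace ℝ ι, exp (-U (ω + ψ)) ∂(multivariateGaussian 0 (A * Aᵀ)))⁻¹ * (∫ ω : EuclideanSpace ℝ ι, exp (-U (ω + ψ)) * U' (ω + ψ)
        (EuclideanSpace.single s (1 : ℝ)) ∂(multivariateGaussian 0 (A * Aᵀ)))))) ∂(multivariateGaussian 0 (A * Aᵀ)))) - ((∫ ω : EuclideanSpace ℝ ι,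
        exp (-U (ω + ψ)) ∂(multivariateGaussian 0 (A * Aᵀ)))⁻¹ * (∫ ω : EuclideanSpace ℝ ι, exp (-U (ω + ψ)) * ((U'' (ω + ψ) (EuclideanSpace.single x
        (1 : ℝ)) (EuclideanSpace.single y (1 : ℝ)) - ((∫ ω : EuclideanSpace ℝ ι, exp (-U (ω + ψ)) ∂(multivariateGaussian 0 (A * Aᵀ)))⁻¹ * (∫ ω :
        EuclideanSpace ℝ ι, exp (-U (ω + ψ)) * U'' (ω + ψ) (EuclideanSpace.single x (1 : ℝ)) (EuclideanSpace.single y (1 : ℝ)) ∂(multivariateGaussian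
        0 (A * Aᵀ))))) * (U' (ω + ψ) (EuclideanSpace.single z (1 : ℝ)) - ((∫ ω : EuclideanSpace ℝ ι, exp (-U (ω + ψ)) ∂(multivariateGaussian 0 (A *
        Aᵀ)))⁻¹ * (∫ ω : EuclideanSpace ℝ ι, exp (-U (ω + ψ)) * U' (ω + ψ) (EuclideanSpace.single z (1 : ℝ)) ∂(multivariateGaussian 0 (A * Aᵀ))))))
        ∂(multivariateGaussian 0 (A * Aᵀ)))) * ((∫ ω : EuclideanSpace ℝ ι, exp (-U (ω + ψ)) ∂(multivariateGaussian 0 (A * Aᵀ)))⁻¹ * (∫ ω :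
        EuclideanSpace ℝ ι, exp (-U (ω + ψ)) * ((U' (ω + ψ) (EuclideanSpace.single t (1 : ℝ)) - ((∫ ω : EuclideanSpace ℝ ι, exp (-U (ω + ψ))
        ∂(multivariateGaussian 0 (A * Aᵀ)))⁻¹ * (∫ ω : EuclideanSpace ℝ ι, exp (-U (ω + ψ)) * U' (ω + ψ) (EuclideanSpace.single t (1 : ℝ))
        ∂(multivariateGaussian 0 (A * Aᵀ))))) * (U' (ω + ψ) (EuclideanSpace.single s (1 : ℝ)) - ((∫ ω : EuclideanSpace ℝ ι, exp (-U (ω + ψ))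
        ∂(multivariateGaussian 0 (A * Aᵀ)))⁻¹ * (∫ ω : EuclideanSpace ℝ ι, exp (-U (ω + ψ)) * U' (ω + ψ) (EuclideanSpace.single s (1 : ℝ))
        ∂(multivariateGaussian 0 (A * Aᵀ)))))) ∂(multivariateGaussian 0 (A * Aᵀ)))) - ((∫ ω : EuclideanSpace ℝ ι, exp (-U (ω + ψ))
        ∂(multivariateGaussian 0 (A * Aᵀ)))⁻¹ * (∫ ω : EuclideanSpace ℝ ι, exp (-U (ω + ψ)) * ((U'' (ω + ψ) (EuclideanSpace.single x (1 : ℝ))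
        (EuclideanSpace.single y (1 : ℝ)) - ((∫ ω : EuclideanSpace ℝ ι, exp (-U (ω + ψ)) ∂(multivariateGaussian 0 (A * Aᵀ)))⁻¹ * (∫ ω :
        EuclideanSpace ℝ ι, exp (-U (ω + ψ)) * U'' (ω + ψ) (EuclideanSpace.single x (1 : ℝ)) (EuclideanSpace.single y (1 : ℝ)) ∂(multivariateGaussian
        0 (A * Aᵀ))))) * (U' (ω + ψ) (EuclideanSpace.single t (1 : ℝ)) - ((∫ ω : EuclideanSpace ℝ ι, exp (-U (ω + ψ)) ∂(multivariateGaussian 0 (A *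
        Aᵀ)))⁻¹ * (∫ ω : EuclideanSpace ℝ ι, exp (-U (ω + ψ)) * U' (ω + ψ) (EuclideanSpace.single t (1 : ℝ)) ∂(multivariateGaussian 0 (A * Aᵀ))))))
        ∂(multivariateGaussian 0 (A * Aᵀ)))) * ((∫ ω : EuclideanSpace ℝ ι, exp (-U (ω + ψ)) ∂(multivariateGaussian 0 (A * Aᵀ)))⁻¹ * (∫ ω :
        EuclideanSpace ℝ ι, exp (-U (ω + ψ)) * ((U' (ω + ψ) (EuclideanSpace.single z (1 : ℝ)) - ((∫ ω : EuclideanSpace ℝ ι, exp (-U (ω + ψ))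
        ∂(multivariateGaussian 0 (A * Aᵀ)))⁻¹ * (∫ ω : EuclideanSpace ℝ ι, exp (-U (ω + ψ)) * U' (ω + ψ) (EuclideanSpace.single z (1 : ℝ))
        ∂(multivariateGaussian 0 (A * Aᵀ))))) * (U' (ω + ψ) (EuclideanSpace.single s (1 : ℝ)) - ((∫ ω : EuclideanSpace ℝ ι, exp (-U (ω + ψ))
        ∂(multivariateGaussian 0 (A * Aᵀ)))⁻¹ * (∫ ω : EuclideanSpace ℝ ι, exp (-U (ω + ψ)) * U' (ω + ψ) (EuclideanSpace.single s (1 : ℝ))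
        ∂(multivariateGaussian 0 (A * Aᵀ)))))) ∂(multivariateGaussian 0 (A * Aᵀ)))) - ((∫ ω : EuclideanSpace ℝ ι, exp (-U (ω + ψ))
        ∂(multivariateGaussian 0 (A * Aᵀ)))⁻¹ * (∫ ω : EuclideanSpace ℝ ι, exp (-U (ω + ψ)) * ((U'' (ω + ψ) (EuclideanSpace.single x (1 : ℝ))
        (EuclideanSpace.single y (1 : ℝ)) - ((∫ ω : EuclideanSpace ℝ ι, exp (-U (ω + ψ)) ∂(multivariateGaussian 0 (A * Aᵀ)))⁻¹ * (∫ ω :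
        EuclideanSpace ℝ ι, exp (-U (ω + ψ)) * U'' (ω + ψ) (EuclideanSpace.single x (1 : ℝ)) (EuclideanSpace.single y (1 : ℝ)) ∂(multivariateGaussian
        0 (A * Aᵀ))))) * (U' (ω + ψ) (EuclideanSpace.single s (1 : ℝ)) - ((∫ ω : EuclideanSpace ℝ ι, exp (-U (ω + ψ)) ∂(multivariateGaussian 0 (A *
        Aᵀ)))⁻¹ * (∫ ω : EuclideanSpace ℝ ι, exp (-U (ω + ψ)) * U' (ω + ψ) (EuclideanSpace.single s (1 : ℝ)) ∂(multivariateGaussian 0 (A * Aᵀ))))))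
        ∂(multivariateGaussian 0 (A * Aᵀ)))) * ((∫ ω : EuclideanSpace ℝ ι, exp (-U (ω + ψ)) ∂(multivariateGaussian 0 (A * Aᵀ)))⁻¹ * (∫ ω :
        EuclideanSpace ℝ ι, exp (-U (ω + ψ)) * ((U' (ω + ψ) (EuclideanSpace.single z (1 : ℝ)) - ((∫ ω : EuclideanSpace ℝ ι, exp (-U (ω + ψ))
        ∂(multivariateGaussian 0 (A * Aᵀ)))⁻¹ * (∫ ω : EuclideanSpace ℝ ι, exp (-U (ω + ψ)) * U' (ω + ψ) (EuclideanSpace.single z (1 : ℝ))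
        ∂(multivariateGaussian 0 (A * Aᵀ))))) * (U' (ω + ψ) (EuclideanSpace.single t (1 : ℝ)) - ((∫ ω : EuclideanSpace ℝ ι, exp (-U (ω + ψ))
        ∂(multivariateGaussian 0 (A * Aᵀ)))⁻¹ * (∫ ω : EuclideanSpace ℝ ι, exp (-U (ω + ψ)) * U' (ω + ψ) (EuclideanSpace.single t (1 : ℝ))
        ∂(multivariateGaussian 0 (A * Aᵀ)))))) ∂(multivariateGaussian 0 (A * Aᵀ))))| ≤
      n * ((4 * (αθ * dθ * (βθ * dθ') / (1 - lamA)) + 3 * (αθ * dθ * (βθ * dθ') / (1 - lamA)) ^ 2 + 4 * (5 * ((κ₂ ^ 4 + κ₃ ^ 4) * γop ^ 2) / (1 - lam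
          * γop) ^ 2) + 4 * (50 * ((κ₂ ^ 6 + κ₃ ^ 6) * γop ^ 3) / (1 - lam * γop) ^ 3) + 2 * (((5 * ((κ₂ ^ 4 + κ₃ ^ 4) * γop ^ 2) / (1 - lam * γop) ^
          2) + 1) / 2) * ((((5 * ((κ₂ ^ 4 + κ₃ ^ 4) * γop ^ 2) / (1 - lam * γop) ^ 2) + 1) / 2) + (5 * ((κ₂ ^ 4 + κ₃ ^ 4) * γop ^ 2) / (1 - lam *
          γop) ^ 2))) * (16 * S ^ 3)) := by
  haveI : Nonempty ι := ⟨x⟩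
  have hUc : Continuous U := continuous_iff_continuousAt.2 fun φ => (hUd φ).continuousAt
  have hU'c : Continuous U' := continuous_iff_continuousAt.2 fun φ => (hU'd φ).continuousAt
  have hU''c : Continuous U'' := continuous_iff_continuousAt.2 fun φ => (hU''d φ).continuousAt
  have h := four_point5_row_letter_hess hΓop Y hUd hU'd hU''d hU₃c hκ₀ hκ₁ ha hτ hδ hθ0 hθ1 hκθ hκθw hstab hU'b hU''b hU₃b hlam hUsec hρg hHk hHk0
      hK3 hK30 ψ hαr hαc hhr hlamA hlamA1 hγ hγ1 hD hDC hθnn hDr hdθ hDc hdθ' hσ0 hσθ hr1 hrσ haσ hβ haσ' hgσ hgσ' hSr hSc x hn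
  refine le_trans (le_of_eq (Finset.sum_congr rfl fun y _ => Finset.sum_congr rfl fun z _ => Finset.sum_congr rfl fun t _ =>
    Finset.sum_congr rfl fun s _ => ?_)) h
  rw [whitened_hess_mean_bridge hUc hU''c A ψ x y, whitened_mean_bridge hUc hU'c A ψ (EuclideanSpace.single z (1 : ℝ)), whitened_mean_bridge hUc hU'c
      A ψ (EuclideanSpace.single t (1 : ℝ)), whitened_mean_bridge hUc hU'c A ψ (EuclideanSpace.single s (1 : ℝ)), whitened_hess_quad_bridge hUc hU'c
      hU''c A ψ, whitened_hess_pair_bridge hUc hU'c hU''c A ψ, whitened_hess_pair_bridge hUc hU'c hU''c A ψ, whitened_hess_pair_bridge hUc hU'c hU''c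
      A ψ, whitened_pair_bridge hUc hU'c A ψ, whitened_pair_bridge hUc hU'c A ψ, whitened_pair_bridge hUc hU'c A ψ]

/-- **THE HESSIAN PAIR NOT CONTAINING `x`, TILTED GAUSSIAN FORMAT**: `Σ_{y,z,t,s}|u₄(F_x,G_{yz},F_t,F_s)| ≤ n·C·16S³`. [folklore] -/
theorem hess_fourth_cumulant_row_letter_tilted_two [Nonempty κ] (hΓop : (γop • (1 : Matrix ι ι ℝ) - A * Aᵀ).PosSemidef) (Y : Finset ι)
    (hUd : ∀ φ : EuclideanSpace ℝ ι, HasFDerivAt U (U' φ) φ) (hU'd : ∀ φ : EuclideanSpace ℝ ι, HasFDerivAt U' (U'' φ) φ)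
    (hU''d : ∀ φ : EuclideanSpace ℝ ι, HasFDerivAt U'' (U₃ φ) φ) (hU₃c : Continuous U₃) (hκ₀ : 0 ≤ κ₀) (hκ₁ : 0 ≤ κ₁) (ha : 0 ≤ a) (hτ : 0 < τ)
    (hδ : 0 < δ) (hθ0 : 0 < θp) (hθ1 : θp < 1) (hκθ : (2 * κ₀ * (1 + τ) + 4 * δ) * γop ≤ θp) (hκθw : 2 * κ₀ * (1 + τ) * γop + 4 * δ ≤ θp)
    (hstab : ∀ φ : EuclideanSpace ℝ ι, -(κ₀ * ∑ x ∈ Y, φ x ^ 2) ≤ U φ)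
    (hU'b : ∀ φ : EuclideanSpace ℝ ι, ‖U' φ‖ ≤ κ₁ * (a + ∑ x ∈ Y, φ x ^ 2)) (hU''b : ∀ φ : EuclideanSpace ℝ ι, ‖U'' φ‖ ≤ κ₂)
    (hU₃b : ∀ φ : EuclideanSpace ℝ ι, ‖U₃ φ‖ ≤ κ₃) (hlam : 0 ≤ lam)
    (hUsec : ∀ s : ℝ, 0 ≤ s → s ≤ 1 → ∀ a b : EuclideanSpace ℝ ι,
      U ((1 - s) • a + s • b) - lam / 2 * (s * (1 - s)) * ∑ i, (a i - b i) ^ 2 ≤ (1 - s) * U a + s * U b)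
    (hρg : lam * γop < 1)
    (hHk : ∀ (φ : EuclideanSpace ℝ ι) (x z : ι), |U'' φ (EuclideanSpace.single z (1 : ℝ)) (EuclideanSpace.single x (1 : ℝ))| ≤ Hk x z)
    (hHk0 : ∀ v u, 0 ≤ Hk v u)
    (hK3 : ∀ (φ : EuclideanSpace ℝ ι) (u x y : ι),
      |U₃ φ (EuclideanSpace.single u (1 : ℝ)) (EuclideanSpace.single x (1 : ℝ)) (EuclideanSpace.single y (1 : ℝ))| ≤ K3 x y u)
    (hK30 : ∀ x y u, 0 ≤ K3 x y u) (ψ : EuclideanSpace ℝ ι)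
    (hαr : ∀ u, ∑ w, |A u w| ≤ αr) (hαc : ∀ w, ∑ u, |A u w| ≤ αc) (hhr : ∀ v, ∑ u, Hk v u ≤ hr)
    (hlamA : ∀ x : κ, ∑ u, ∑ v, |A u x| * |A v x| * Hk v u ≤ lamA) (hlamA1 : lamA < 1) (hγ : αc * hr * αr / (1 - lamA) ≤ γ) (hγ1 : γ < 1)
    -- the admissible `D` with weighted letters, the weights, the profiles (gradient vectors at their sites, Hessian vectors at the first site)
    (hD : ∀ x y, 0 ≤ D x y)
    (hDC : ∀ x y, (if x = y then (1 : ℝ) else 0) + ∑ z, D x z * ((if y = z then 0 else ∑ u, ∑ v, |A u y| * |A v z| * Hk v u) / (1 - lamA)) ≤ D x y)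
    (hθnn : ∀ z w, 0 ≤ θ z w) (hDr : ∀ z, ∑ w, D z w * θ z w ≤ dθ) (hdθ : 0 ≤ dθ) (hDc : ∀ w, ∑ z, D z w * θ z w ≤ dθ') (hdθ' : 0 ≤ dθ')
    (hσ0 : ∀ x w, 0 ≤ σ x w) (hσθ : ∀ x z w, σ x w ≤ σ x z * θ z w) (hr1 : ∀ x y, 1 ≤ r x y) (hrσ : ∀ x y w, r x y ^ 24 ≤ σ x w * σ y w)
    (haσ : ∀ v : ι, ∑ w, (∑ u, |A u w| * Hk v u) * σ v w ≤ αθ) (hβ : 0 ≤ βθ) (haσ' : ∀ (v : ι) (w : κ), (∑ u, |A u w| * Hk v u) * σ v w ≤ βθ)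
    (hgσ : ∀ p q : ι, ∑ w, (∑ u, |A u w| * K3 p q u) * σ p w ≤ αθ) (hgσ' : ∀ (p q : ι) (w : κ), (∑ u, |A u w| * K3 p q u) * σ p w ≤ βθ)
    (hSr : ∀ u, ∑ v, (r u v ^ 2)⁻¹ ≤ S) (hSc : ∀ v, ∑ u, (r u v ^ 2)⁻¹ ≤ S) (x : ι)
    (hn : ∀ y : ι, (Finset.univ.filter (fun z => Hk z y ≠ 0)).card ≤ n) :
    ∑ y, ∑ z, ∑ t, ∑ s, |((∫ ω : EuclideanSpace ℝ ι, exp (-U (ω + ψ)) ∂(multivariateGaussian 0 (A * Aᵀ)))⁻¹ * (∫ ω : EuclideanSpace ℝ ι, exp (-U (ω +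
        ψ)) * ((U' (ω + ψ) (EuclideanSpace.single x (1 : ℝ)) - ((∫ ω : EuclideanSpace ℝ ι, exp (-U (ω + ψ)) ∂(multivariateGaussian 0 (A * Aᵀ)))⁻¹ *
        (∫ ω : EuclideanSpace ℝ ι, exp (-U (ω + ψ)) * U' (ω + ψ) (EuclideanSpace.single x (1 : ℝ)) ∂(multivariateGaussian 0 (A * Aᵀ))))) * (U'' (ω +
        ψ) (EuclideanSpace.single y (1 : ℝ)) (EuclideanSpace.single z (1 : ℝ)) - ((∫ ω : EuclideanSpace ℝ ι, exp (-U (ω + ψ)) ∂(multivariateGaussian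
        0 (A * Aᵀ)))⁻¹ * (∫ ω : EuclideanSpace ℝ ι, exp (-U (ω + ψ)) * U'' (ω + ψ) (EuclideanSpace.single y (1 : ℝ)) (EuclideanSpace.single z (1 :
        ℝ)) ∂(multivariateGaussian 0 (A * Aᵀ))))) * (U' (ω + ψ) (EuclideanSpace.single t (1 : ℝ)) - ((∫ ω : EuclideanSpace ℝ ι, exp (-U (ω + ψ))
        ∂(multivariateGaussian 0 (A * Aᵀ)))⁻¹ * (∫ ω : EuclideanSpace ℝ ι, exp (-U (ω + ψ)) * U' (ω + ψ) (EuclideanSpace.single t (1 : ℝ))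
        ∂(multivariateGaussian 0 (A * Aᵀ))))) * (U' (ω + ψ) (EuclideanSpace.single s (1 : ℝ)) - ((∫ ω : EuclideanSpace ℝ ι, exp (-U (ω + ψ))
        ∂(multivariateGaussian 0 (A * Aᵀ)))⁻¹ * (∫ ω : EuclideanSpace ℝ ι, exp (-U (ω + ψ)) * U' (ω + ψ) (EuclideanSpace.single s (1 : ℝ))
        ∂(multivariateGaussian 0 (A * Aᵀ)))))) ∂(multivariateGaussian 0 (A * Aᵀ)))) - ((∫ ω : EuclideanSpace ℝ ι, exp (-U (ω + ψ))
        ∂(multivariateGaussian 0 (A * Aᵀ)))⁻¹ * (∫ ω : EuclideanSpace ℝ ι, exp (-U (ω + ψ)) * ((U' (ω + ψ) (EuclideanSpace.single x (1 : ℝ)) - ((∫ ω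
        : EuclideanSpace ℝ ι, exp (-U (ω + ψ)) ∂(multivariateGaussian 0 (A * Aᵀ)))⁻¹ * (∫ ω : EuclideanSpace ℝ ι, exp (-U (ω + ψ)) * U' (ω + ψ)
        (EuclideanSpace.single x (1 : ℝ)) ∂(multivariateGaussian 0 (A * Aᵀ))))) * (U'' (ω + ψ) (EuclideanSpace.single y (1 : ℝ))
        (EuclideanSpace.single z (1 : ℝ)) - ((∫ ω : EuclideanSpace ℝ ι, exp (-U (ω + ψ)) ∂(multivariateGaussian 0 (A * Aᵀ)))⁻¹ * (∫ ω :
        EuclideanSpace ℝ ι, exp (-U (ω + ψ)) * U'' (ω + ψ) (EuclideanSpace.single y (1 : ℝ)) (EuclideanSpace.single z (1 : ℝ)) ∂(multivariateGaussian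
        0 (A * Aᵀ)))))) ∂(multivariateGaussian 0 (A * Aᵀ)))) * ((∫ ω : EuclideanSpace ℝ ι, exp (-U (ω + ψ)) ∂(multivariateGaussian 0 (A * Aᵀ)))⁻¹ *
        (∫ ω : EuclideanSpace ℝ ι, exp (-U (ω + ψ)) * ((U' (ω + ψ) (EuclideanSpace.single t (1 : ℝ)) - ((∫ ω : EuclideanSpace ℝ ι, exp (-U (ω + ψ))
        ∂(multivariateGaussian 0 (A * Aᵀ)))⁻¹ * (∫ ω : EuclideanSpace ℝ ι, exp (-U (ω + ψ)) * U' (ω + ψ) (EuclideanSpace.single t (1 : ℝ))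
        ∂(multivariateGaussian 0 (A * Aᵀ))))) * (U' (ω + ψ) (EuclideanSpace.single s (1 : ℝ)) - ((∫ ω : EuclideanSpace ℝ ι, exp (-U (ω + ψ))
        ∂(multivariateGaussian 0 (A * Aᵀ)))⁻¹ * (∫ ω : EuclideanSpace ℝ ι, exp (-U (ω + ψ)) * U' (ω + ψ) (EuclideanSpace.single s (1 : ℝ))
        ∂(multivariateGaussian 0 (A * Aᵀ)))))) ∂(multivariateGaussian 0 (A * Aᵀ)))) - ((∫ ω : EuclideanSpace ℝ ι, exp (-U (ω + ψ))
        ∂(multivariateGaussian 0 (A * Aᵀ)))⁻¹ * (∫ ω : EuclideanSpace ℝ ι, exp (-U (ω + ψ)) * ((U' (ω + ψ) (EuclideanSpace.single x (1 : ℝ)) - ((∫ ω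
        : EuclideanSpace ℝ ι, exp (-U (ω + ψ)) ∂(multivariateGaussian 0 (A * Aᵀ)))⁻¹ * (∫ ω : EuclideanSpace ℝ ι, exp (-U (ω + ψ)) * U' (ω + ψ)
        (EuclideanSpace.single x (1 : ℝ)) ∂(multivariateGaussian 0 (A * Aᵀ))))) * (U' (ω + ψ) (EuclideanSpace.single t (1 : ℝ)) - ((∫ ω :
        EuclideanSpace ℝ ι, exp (-U (ω + ψ)) ∂(multivariateGaussian 0 (A * Aᵀ)))⁻¹ * (∫ ω : EuclideanSpace ℝ ι, exp (-U (ω + ψ)) * U' (ω + ψ)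
        (EuclideanSpace.single t (1 : ℝ)) ∂(multivariateGaussian 0 (A * Aᵀ)))))) ∂(multivariateGaussian 0 (A * Aᵀ)))) * ((∫ ω : EuclideanSpace ℝ ι,
        exp (-U (ω + ψ)) ∂(multivariateGaussian 0 (A * Aᵀ)))⁻¹ * (∫ ω : EuclideanSpace ℝ ι, exp (-U (ω + ψ)) * ((U'' (ω + ψ) (EuclideanSpace.single y
        (1 : ℝ)) (EuclideanSpace.single z (1 : ℝ)) - ((∫ ω : EuclideanSpace ℝ ι, exp (-U (ω + ψ)) ∂(multivariateGaussian 0 (A * Aᵀ)))⁻¹ * (∫ ω :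
        EuclideanSpace ℝ ι, exp (-U (ω + ψ)) * U'' (ω + ψ) (EuclideanSpace.single y (1 : ℝ)) (EuclideanSpace.single z (1 : ℝ)) ∂(multivariateGaussian
        0 (A * Aᵀ))))) * (U' (ω + ψ) (EuclideanSpace.single s (1 : ℝ)) - ((∫ ω : EuclideanSpace ℝ ι, exp (-U (ω + ψ)) ∂(multivariateGaussian 0 (A *
        Aᵀ)))⁻¹ * (∫ ω : EuclideanSpace ℝ ι, exp (-U (ω + ψ)) * U' (ω + ψ) (EuclideanSpace.single s (1 : ℝ)) ∂(multivariateGaussian 0 (A * Aᵀ))))))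
        ∂(multivariateGaussian 0 (A * Aᵀ)))) - ((∫ ω : EuclideanSpace ℝ ι, exp (-U (ω + ψ)) ∂(multivariateGaussian 0 (A * Aᵀ)))⁻¹ * (∫ ω :
        EuclideanSpace ℝ ι, exp (-U (ω + ψ)) * ((U' (ω + ψ) (EuclideanSpace.single x (1 : ℝ)) - ((∫ ω : EuclideanSpace ℝ ι, exp (-U (ω + ψ))
        ∂(multivariateGaussian 0 (A * Aᵀ)))⁻¹ * (∫ ω : EuclideanSpace ℝ ι, exp (-U (ω + ψ)) * U' (ω + ψ) (EuclideanSpace.single x (1 : ℝ))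
        ∂(multivariateGaussian 0 (A * Aᵀ))))) * (U' (ω + ψ) (EuclideanSpace.single s (1 : ℝ)) - ((∫ ω : EuclideanSpace ℝ ι, exp (-U (ω + ψ))
        ∂(multivariateGaussian 0 (A * Aᵀ)))⁻¹ * (∫ ω : EuclideanSpace ℝ ι, exp (-U (ω + ψ)) * U' (ω + ψ) (EuclideanSpace.single s (1 : ℝ))
        ∂(multivariateGaussian 0 (A * Aᵀ)))))) ∂(multivariateGaussian 0 (A * Aᵀ)))) * ((∫ ω : EuclideanSpace ℝ ι, exp (-U (ω + ψ))
        ∂(multivariateGaussian 0 (A * Aᵀ)))⁻¹ * (∫ ω : EuclideanSpace ℝ ι, exp (-U (ω + ψ)) * ((U'' (ω + ψ) (EuclideanSpace.single y (1 : ℝ))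
        (EuclideanSpace.single z (1 : ℝ)) - ((∫ ω : EuclideanSpace ℝ ι, exp (-U (ω + ψ)) ∂(multivariateGaussian 0 (A * Aᵀ)))⁻¹ * (∫ ω :
        EuclideanSpace ℝ ι, exp (-U (ω + ψ)) * U'' (ω + ψ) (EuclideanSpace.single y (1 : ℝ)) (EuclideanSpace.single z (1 : ℝ)) ∂(multivariateGaussian
        0 (A * Aᵀ))))) * (U' (ω + ψ) (EuclideanSpace.single t (1 : ℝ)) - ((∫ ω : EuclideanSpace ℝ ι, exp (-U (ω + ψ)) ∂(multivariateGaussian 0 (A *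
        Aᵀ)))⁻¹ * (∫ ω : EuclideanSpace ℝ ι, exp (-U (ω + ψ)) * U' (ω + ψ) (EuclideanSpace.single t (1 : ℝ)) ∂(multivariateGaussian 0 (A * Aᵀ))))))
        ∂(multivariateGaussian 0 (A * Aᵀ))))| ≤
      n * ((4 * (αθ * dθ * (βθ * dθ') / (1 - lamA)) + 3 * (αθ * dθ * (βθ * dθ') / (1 - lamA)) ^ 2 + 4 * (5 * ((κ₂ ^ 4 + κ₃ ^ 4) * γop ^ 2) / (1 - lam
          * γop) ^ 2) + 4 * (50 * ((κ₂ ^ 6 + κ₃ ^ 6) * γop ^ 3) / (1 - lam * γop) ^ 3) + 2 * (((5 * ((κ₂ ^ 4 + κ₃ ^ 4) * γop ^ 2) / (1 - lam * γop) ^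
          2) + 1) / 2) * ((((5 * ((κ₂ ^ 4 + κ₃ ^ 4) * γop ^ 2) / (1 - lam * γop) ^ 2) + 1) / 2) + (5 * ((κ₂ ^ 4 + κ₃ ^ 4) * γop ^ 2) / (1 - lam *
          γop) ^ 2))) * (16 * S ^ 3)) := by
  haveI : Nonempty ι := ⟨x⟩
  have hUc : Continuous U := continuous_iff_continuousAt.2 fun φ => (hUd φ).continuousAt
  have hU'c : Continuous U' := continuous_iff_continuousAt.2 fun φ => (hU'd φ).continuousAt
  have hU''c : Continuous U'' := continuous_iff_continuousAt.2 fun φ => (hU''d φ).continuousAt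
  have h := four_point5_row_letter_hess_two hΓop Y hUd hU'd hU''d hU₃c hκ₀ hκ₁ ha hτ hδ hθ0 hθ1 hκθ hκθw hstab hU'b hU''b hU₃b hlam hUsec hρg hHk
      hHk0 hK3 hK30 ψ hαr hαc hhr hlamA hlamA1 hγ hγ1 hD hDC hθnn hDr hdθ hDc hdθ' hσ0 hσθ hr1 hrσ haσ hβ haσ' hgσ hgσ' hSr hSc x hn
  refine le_trans (le_of_eq (Finset.sum_congr rfl fun y _ => Finset.sum_congr rfl fun z _ => Finset.sum_congr rfl fun t _ =>
    Finset.sum_congr rfl fun s _ => ?_)) h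
  rw [whitened_mean_bridge hUc hU'c A ψ (EuclideanSpace.single x (1 : ℝ)), whitened_hess_mean_bridge hUc hU''c A ψ y z, whitened_mean_bridge hUc hU'c
      A ψ (EuclideanSpace.single t (1 : ℝ)), whitened_mean_bridge hUc hU'c A ψ (EuclideanSpace.single s (1 : ℝ)), whitened_grad_hess_quad_bridge hUc
      hU'c hU''c A ψ, whitened_grad_hess_pair_bridge hUc hU'c hU''c A ψ, whitened_pair_bridge hUc hU'c A ψ, whitened_pair_bridge hUc hU'c A ψ,
      whitened_hess_pair_bridge hUc hU'c hU''c A ψ, whitened_pair_bridge hUc hU'c A ψ, whitened_hess_pair_bridge hUc hU'c hU''c A ψ]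

/-! ## Toy -/

/-- Toy (three pairings of four slots): `3 = 4·3∕2∕2`. -/
example : (3 : ℕ) = 4 * 3 / 2 / 2 := by norm_num

end Summit.QuantumFields.BalabanUV.T4Continuum.NE7b.SupHessFourthCumulantRowLettersTilted

end
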